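import Mathlib.Algebra.Polynomial.Eval.Defs
import Mathlib.Algebra.Field.ZMod
import Mathlib.Analysis.SpecialFunctions.Pow.Real
import Mathlib.Analysis.SpecialFunctions.Exp
import Literature.Computability.QuantumComplexity.ShallowCircuitRelations
import Literature.Computability.QuantumComplexity.ShallowCircuitsRing
import Literature.Computability.Complexity.ConstantDepth
import Literature.Computability.MetaComplexity.SmolenskyProperty
import Literature.Computability.MetaComplexity.RobustHegedusLemma
import HarnessLib
import Summits.QuantumAdvantage.AdviceFreeQNC0.AdviceFreeQNC0
import Summits.QuantumAdvantage.QuantumAdvantage.Theses.RingFrame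

/-!
# RingToElim — birth skeleton (BC3) of crux α of route `RingFrame`, line `tensor` (qa-qnc0-p2, rung F-Q1)

PUBLISHED FORM (opener qa-qnc0-p1 gen 6 for qa-qnc0-p2, skeleton v3 of 2026-08-25T21:47Z): Parts 1–2 — the leaf file
(`Summits.QuantumAdvantage.AdviceFreeQNC0.AdviceFreeQNC0`) and the gate-rendered route file (`…Theses.RingFrame`) — are IMPORTED;
this file is Part 3, published as `Cruxes/RingToElim/Lines/tensor.lean`.

Part 3 = the line: `ElimHard ⟹ CrossTeamHardPolylog ⟹ RingHardU ⟹ RingHard 2`, three registered stubs and the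
kernel-checked composition `RingToElim_of`.  The load-bearing stub is `stub_cross` (ROUND-1 §9.23–9.25: three-mode XOR law,
CrossTeam ≡ W₂ product game, tensor-robustness reduction TR + robust Hegedűs + nine-block endgame); `stub_embed` is the
aggregation of a walk strategy into a cross-team profile (phases `ω^{W_g}` are own-block data, the common factor `ω^{|v|}`
is the twist), `stub_transport` is the trace-form dictionary ring ↔ walk (`θ = (1+θ')/2`).
-/

open Finset
open Literature.Computability.Cryptography Literature.Computability.Complexity
open Literature.Computability.QuantumComplexity Literature.Computability.MetaComplexity

set_option linter.dupNamespace false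

/-! ## Parts 1–2 — IMPORTED: the leaf (p409171, commit de7c67c6d7f5) and the gate-rendered route file (`…Theses.RingFrame.RingToElim`). -/

/-! ## Part 3 — the line `tensor` -/
namespace Summit.QuantumAdvantage.QuantumAdvantage.Cruxes.RingToElim.Tensor

open Literature.Computability.MetaComplexity.Smolensky

/-- `GF(2)`-degree `≤ d` of a Boolean function on the cube (tree `Smolensky.lowDeg`). -/
def HasDeg {N : ℕ} (f : (Fin N → Bool) → Bool) (d : ℕ) : Prop :=
  (fun x => if f x then (1 : ZMod 2) else 0) ∈ lowDeg (ZMod 2) N d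

/-- Hamming weight (= tree `Hegedus.wt`). -/
def wt {n : ℕ} (u : Fin n → Bool) : ℕ := (univ.filter fun i : Fin n => u i = true).card

/-- prefix weight `W_g(u) = #{i < g : u_i = 1}`. -/
def wtPrefix {n : ℕ} (u : Fin n → Bool) (g : ℕ) : ℕ := (univ.filter fun i : Fin n => i.val < g ∧ u i = true).card

/-- walk exponent `e_g(u) = W(u) + W_g(u)`. -/
def walkExp {n : ℕ} (u : Fin n → Bool) (g : ℕ) : ℕ := wt u + wtPrefix u g

/-- WIN of the ring game in walk coordinates (charge `c`; cell sketch `ringWinU`). -/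
def ringWinU {n : ℕ} (c : ℕ) (y : Fin (n + 1) → (Fin n → Bool) → Bool) (u : Fin n → Bool) : Bool :=
  decide ((univ.filter fun g : Fin (n + 1) => y g u = true ∧ (c + g.val + walkExp u g.val) % 3 ≠ 0).card % 2 = 1)

/-- **RingHardU** — the ring crux in walk coordinates at the trace-form charge `c = n + 2` (cell sketch, verbatim). -/
def RingHardU : Prop :=
  ∃ θ : ℝ, θ < 1 ∧ ∀ C : ℕ, ∃ n₀ : ℕ, ∀ n ≥ n₀, ∀ y : Fin (n + 1) → (Fin n → Bool) → Bool,
    (∀ g, HasDeg (y g) ((Nat.log 2 n) ^ C)) →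
      ((univ.filter fun u : Fin n → Bool => ringWinU (n + 2) y u = true).card : ℝ) ≤ θ * (2 : ℝ) ^ n

/-! ### the cross-team game (cell sketch `CrossTeam.*`, verbatim) -/
abbrev T4 := Bool × Bool        -- (a, b) ↦ a + b·ω ∈ 𝔽₄

def t4add (p q : T4) : T4 := (xor p.1 q.1, xor p.2 q.2)
/-- multiplication by `ω`: `(a + bω)ω = b + (a + b)ω`. -/
def tMulOmega (p : T4) : T4 := (p.2, xor p.1 p.2)
def tOmegaPow (r : ℕ) (p : T4) : T4 := tMulOmega^[r % 3] p

/-- cross-degree `≤ d`: for every own input, both coordinates are degree-`≤ d` functions of the other block. -/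
def CrossDeg {L L' : ℕ} (d : ℕ) (F : (Fin L → Bool) → (Fin L' → Bool) → T4) : Prop :=
  ∀ u, HasDeg (fun v => (F u v).1) d ∧ HasDeg (fun v => (F u v).2) d

/-- the referee: `X = Λ₀ + ω^{|u|}Λ₁ ∉ {0, ω^{2(c + |u| + |v|)}}`. -/
def crossWin {L L' : ℕ} (c : ℕ) (F₀ : (Fin L → Bool) → (Fin L' → Bool) → T4) (F₁ : (Fin L' → Bool) → (Fin L → Bool) → T4)
    (u : Fin L → Bool) (v : Fin L' → Bool) : Bool :=
  let X := t4add (F₀ u v) (tOmegaPow (wt u) (F₁ v u))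
  decide (X ≠ (false, false) ∧ X ≠ tOmegaPow (2 * (c + wt u + wt v)) (true, false))

def crossWinCount {L L' : ℕ} (c : ℕ) (F₀ : (Fin L → Bool) → (Fin L' → Bool) → T4) (F₁ : (Fin L' → Bool) → (Fin L → Bool) → T4) : ℕ :=
  (univ.filter fun p : (Fin L → Bool) × (Fin L' → Bool) => crossWin c F₀ F₁ p.1 p.2 = true).card

/-- **CrossTeamHardPolylog**: some `θ < 1`; for every `C`, all large blocks, every charge, every profile of cross-degree
`≤ (log₂ (min L L'))^C` wins on at most `θ·2^{L+L'}` cells (polylog of the SMALLER block: a member whose cross-degree reaches the other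
block's length knows everything — ERRATUM E5; `stub_embed` uses the balanced split). -/
def CrossTeamHardPolylog : Prop :=
  ∃ θ : ℝ, θ < 1 ∧ ∀ C : ℕ, ∃ L₀ : ℕ, ∀ L L' : ℕ, L₀ ≤ L → L₀ ≤ L' →
    ∀ c : ℕ, ∀ F₀ : (Fin L → Bool) → (Fin L' → Bool) → T4, ∀ F₁ : (Fin L' → Bool) → (Fin L → Bool) → T4,
      CrossDeg ((Nat.log 2 (min L L')) ^ C) F₀ → CrossDeg ((Nat.log 2 (min L L')) ^ C) F₁ →
        (crossWinCount c F₀ F₁ : ℝ) ≤ θ * (2 : ℝ) ^ (L + L')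

/-- the elimination-hardness hypothesis `E` of the crux (= the antecedent of `RingFrame.RingToElim`, verbatim). -/
def ElimHard : Prop := ∃ η₀ : ℝ, 0 < η₀ ∧ ∀ C : ℕ, ∃ n₀ : ℕ, ∀ n ≥ n₀, ∀ a b : Literature.Computability.MetaComplexity.Smolensky.CubeFn (ZMod 2) n, a ∈ Literature.Computability.MetaComplexity.Smolensky.lowDeg (ZMod 2) n ((Nat.log 2 n) ^ C) → b ∈ Literature.Computability.MetaComplexity.Smolensky.lowDeg (ZMod 2) n ((Nat.log 2 n) ^ C) → ∀ dec : ZMod 2 → ZMod 2 → ℕ, η₀ * (2 : ℝ) ^ n ≤ ((Finset.univ.filter fun u : Fin n → Bool => dec (a u) (b u) % 3 = Literature.Computability.MetaComplexity.Hegedus.wt u % 3).card : ℝ)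

/-! ### augmented elimination codes and the tensor-robustness statement TR⁺ (ROUND-1 §9.26–9.27) -/

/-- membership in the AUGMENTED ELIMINATION CODE `C⁺_L(d) = C_L(d) ⊕ ⟨𝟙⟩`: piecewise `GF(2)`-degree `≤ d` on the three residue classes of
`|u| mod 3`, the three pieces summing to a constant (`C_L(d)` itself: constant `0`; success sets of degree-`d` probes lie in `C`, failure
sets in `𝟙 + C`). -/
def InCPlus {L : ℕ} (d : ℕ) (f : (Fin L → Bool) → Bool) : Prop :=
  ∃ Q₀ Q₁ Q₂ : (Fin L → Bool) → Bool, HasDeg Q₀ d ∧ HasDeg Q₁ d ∧ HasDeg Q₂ d ∧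
    (∃ e : Bool, ∀ u, xor (Q₀ u) (xor (Q₁ u) (Q₂ u)) = e) ∧
    ∀ u, f u = (if wt u % 3 = 0 then Q₀ u else if wt u % 3 = 1 then Q₁ u else Q₂ u)

/-- Hamming weight of a Boolean matrix on `{0,1}^L × {0,1}^{L'}`. -/
def hw {L L' : ℕ} (X : (Fin L → Bool) → (Fin L' → Bool) → Bool) : ℕ :=
  (univ.filter fun p : (Fin L → Bool) × (Fin L' → Bool) => X p.1 p.2 = true).card

/-- entrywise sum of two Boolean matrices. -/
def xorM {L L' : ℕ} (X Y : (Fin L → Bool) → (Fin L' → Bool) → Bool) : (Fin L → Bool) → (Fin L' → Bool) → Bool :=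
  fun u v => xor (X u v) (Y u v)

/-- every column (a function of `u`) lies in `C⁺_L(d)`. -/
def ColsIn {L L' : ℕ} (d : ℕ) (X : (Fin L → Bool) → (Fin L' → Bool) → Bool) : Prop := ∀ v, InCPlus d (fun u => X u v)
/-- every row (a function of `v`) lies in `C⁺_{L'}(d)`. -/
def RowsIn {L L' : ℕ} (d : ℕ) (X : (Fin L → Bool) → (Fin L' → Bool) → Bool) : Prop := ∀ u, InCPlus d (fun v => X u v)

/-- **TR⁺ (with additive slack) — tensor robustness of the augmented elimination codes, UNIFORM in the degree** (ROUND-1 §9.27–9.28,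
LIT-MEMO-7 §1; the load-bearing open lemma of line `tensor`): for every slack `ε > 0` there is `K` such that for all large blocks and every
cross-degree `d ≤ (log₂ min(L,L'))^C`, a matrix `X` whose columns are in `C⁺_L(d)` is within `K·|X + Y| + ε·2^{L+L'}` of the tensor code
`C⁺_L(d) ⊗ C⁺_{L'}(d)` for every `Y` whose rows are in `C⁺_{L'}(d)`.  Equivalent (up to constants) to ordinary robustness of the row/column test for
`C⁺⊗C⁺` at constant relative distance from the tensor code; the slack makes sparse identity-type far words (Goldreich–Meir, Kaufman–?; weight
`≤ 2^{-d}`-fraction) harmless.  NOT IN PRINT either way for Reed–Muller-type pairs (GSW24 arXiv:2410.22606 pp. 3–4; CMS20 §2.2); generic theorems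
(Ben-Sasson–Sudan 2006, Dinur–Sudan–Wigderson 2006, Ben-Sasson–Viderman 2009) give `K = 2^{O(d)}` only; Coppersmith–Rudra 2005 / Valiant 2005 /
Goldreich–Meir 2007 are the counterexample templates (rows EXACTLY in `C₁`). -/
def TRPlus : Prop :=
  ∀ ε : ℝ, 0 < ε → ∃ K : ℝ, 0 < K ∧ ∀ C : ℕ, ∃ L₀ : ℕ, ∀ L L' : ℕ, L₀ ≤ L → L₀ ≤ L' → ∀ d : ℕ, d ≤ (Nat.log 2 (min L L')) ^ C →
    ∀ X Y : (Fin L → Bool) → (Fin L' → Bool) → Bool, ColsIn d X → RowsIn d Y →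
      ∃ W : (Fin L → Bool) → (Fin L' → Bool) → Bool, ColsIn d W ∧ RowsIn d W ∧
        (hw (xorM X W) : ℝ) ≤ K * hw (xorM X Y) + ε * (2 : ℝ) ^ (L + L')

/-! ### the stubs -/

/-- **stub_TRplus (load-bearing, L): `TR⁺`.** Pure coding theory; see the docstring of `TRPlus`. -/
theorem stub_TRplus : TRPlus := by
  sorry

/-- **stub_coset (M): `TR⁺ ⟹ (ElimHard ⟹ CrossTeamHardPolylog)`** — ROUND-1 §9.26–9.27, PROVED in prose: three-mode XOR law
(WIN = M₀ ⊕ M₁, rows of the failure matrix `F₀` in `𝟙 + C_{L'}(d)`, columns of the success matrix `S₁` in `C_L(d)`, LOSE = F₀ Δ S₁), so a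
light LOSE set is `Z = X + Y'` with `X ∈ C_L⊗A`, `Y' ∈ A⊗(𝟙+C_{L'})`; `TR⁺` gives `W ∈ C⁺⊗C⁺` near `X`; in
`C₁⁺⊗C₂⁺ = C₁⊗C₂ ⊕ C₁⊗𝟙 ⊕ 𝟙⊗C₂ ⊕ ⟨𝟙⊗𝟙⟩` write `W = W₀ + a⊗𝟙 + 𝟙⊗b + ε𝟙⊗𝟙`; `ElimHard` (every word of `𝟙 + C_L(d)` weighs `≥ η₀2^L`)
forces `b + e𝟙` and `a + (1+e)𝟙` to be light, and one of them lies in an odd coset — contradiction unless `|Z| ≥ (η₀² − ε)·2^{L+L'}/(K+1)`;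
with the slack `ε := η₀²/2` this gives `θ = 1 − η₀²/(2(K(ε)+1))`. -/
theorem stub_coset : TRPlus → ElimHard → CrossTeamHardPolylog := by
  sorry

/-- **stub_embed (M).** A walk strategy `y` of degree `≤ (log₂ n)^C` on `n = L + L'` bits (balanced split `L = ⌊n/2⌋`) aggregates, block by
block, into a cross-team profile of cross-degree `≤ (log₂ min(L,L'))^{2C}` with the same win set (`Λ_j = Σ_{g ∈ B_j} y_g ω^{W_g}`; the common
factor `ω^{|v|}` of block 0 is the twist; kernel check `crossTeam_embeds_const_two` of the cell sketch pins the conventions). -/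
theorem stub_embed : CrossTeamHardPolylog → RingHardU := by
  sorry

/-- **stub_transport (M).** Trace-form dictionary (cell sketch `TraceForm`, kernel-checked at `N = 7`): on the transversal class of patterns
the ring relation `RingHLF.Rel x z` is the walk game at charge `n + 2` in the coordinates `u = uPrefix x`, `y = ỹ(x, z)` (affine,
degree-preserving); conceding the other class gives `RingHard 2` with `θ = (1 + θ')/2`. -/
theorem stub_transport : RingHardU → Summit.QuantumAdvantage.AdviceFreeQNC0.RingHard 2 := by
  sorry

/-- the composition: the four stubs give the route crux BY NAME. -/
theorem RingToElim_of : Summit.QuantumAdvantage.QuantumAdvantage.Theses.RingFrame.RingToElim := by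
  intro hE
  exact stub_transport (stub_embed (stub_coset stub_TRplus hE))


end Summit.QuantumAdvantage.QuantumAdvantage.Cruxes.RingToElim.Tensor
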